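import Summits.RiemannHypothesis.RiemannHypothesis.Theses.WeilWindowFlow
import Summits.RiemannHypothesis.RiemannHypothesis.Theorems.GronwallLeakage.Negative.Structure
import Summits.RiemannHypothesis.RiemannHypothesis.Theorems.WeilWindowFlowGronwallLeakageStubAcOfDini
import Summits.RiemannHypothesis.RiemannHypothesis.Theorems.WeilWindowFlowGronwallLeakageStubFiniteDiniOffCountable
import Summits.RiemannHypothesis.RiemannHypothesis.Theorems.WeilWindowFlowGronwallLeakageIffWeilPos
import Literature.NumberTheory.LFunctions.WeilWindowSuzukiContinuityProofs
import Literature.Analysis.FluidPDE.IntegratedChainRule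
import HarnessLib.Audit

/-!
# Line `Sketch` — skeleton for crux `WeilWindowFlow.GronwallLeakage`
(item stmt-RiemannHypothesis-1037, route route-RiemannHypothesis-WeilWindowFlow; line leads
prover-line-stmt-RiemannHypothesis-1037-0 (revs 1–2), -1 (gen 1), -c1-0 (rev 3), 2026-08-16)

REV 3 (continuation c1, 10:40Z): the one open stub is RESTATED VERBATIM as the signature of the EXISTING shared
item stmt-RiemannHypothesis-0098 (`∀ a > 0, WeilPositivityOn a` = `UniformWeilPositivity`, thesis of routes
WeilPos / WeilComb / WeilAdversary): `stub_uniformWeilPositivity`. This is not a weakening or a new cut — it is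
kernel-checked equivalent to the old `stub_strictPos` (`strictPos_iff_uniformWeilPositivity`, p95911) and to the
crux itself (`gronwallLeakage_iff_uniformWeilPositivity`, p95911; `gronwallLeakage_iff_riemannHypothesis`,
p90753). So the skeleton closes the crux modulo item 0098 and nothing else: whatever term closes 0098 closes
1037 by the one-liner recorded at the end of this file. `strictPos_of_stub` recovers the old stub as sorry-free glue.

REV 2 (08:10Z): stubs 2 and 3 are LANDED tree theorems (`stub_finiteDiniOffCountable` p90448 — unconditional
since crux 1039 `WindowLipschitz` closed 07:19Z, via the bridge p88854; `stub_acOfDini` p87117), imported and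
discharged below by name; the only `sorry` left is `stub_strictPos`, which is EQUIVALENT to the Riemann hypothesis
(`strictPos_iff_riemannHypothesis`, landed p88152). The skeleton therefore closes the crux modulo RH and nothing
else; `GronwallLeakage ↔ RiemannHypothesis` is landed separately (`Theorems/WeilWindowFlowGronwallLeakageIffRH.lean`).

Crux (BY NAME, never restated): `Summit.RiemannHypothesis.RiemannHypothesis.Theses.WeilWindowFlow.GronwallLeakage`
= `∃ C, ∀ b a, 0 < b → b ≤ a → IntervalIntegrable C volume b a ∧ ε b * exp (-(∫ x in b..a, C x)) ≤ ε a`,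
`ε = Literature.NumberTheory.LFunctions.weilGroundEnergy`.

## The cut (card `nearly-everywhere-dini-split` of the picked line `Sketch` = `SketchIdeator3.lean`)

The landed structure theorem `gronwallLeakage_iff_pos_and_logAC`
(`Theorems/GronwallLeakage/Negative/Structure.lean`) says `X ⟺ StrictPos ∧ LogAC`. The skeleton proves `X` from
three registered stubs:

* `stub_strictPos` — `∀ a > 0, 0 < ε a` (**RH-equivalent**: `→ RH` by Yoshida's criterion, `← RH` by the landed
  `strictUnderRH_proof`; held by the lead as a calibration, no proof is claimed) — rev 3: restated verbatim as
  item 0098's signature `stub_uniformWeilPositivity`, with `strictPos_of_stub` as glue;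
* `stub_finiteDiniOffCountable` — off a countable set of windows the lower-right Dini derivate of `ε` is finite
  (unconditional, open; strictly weaker than the sibling cruxes `WindowLipschitz` (1039) and `DiniLeakage` (1038));
* `stub_acOfDini` — the real-analysis engine, GENERIC in `f`: a continuous antitone function on `[b, a]` whose
  lower-right Dini derivate is finite at every point of `[b, a)` outside a countable set is absolutely continuous on
  `[b, a]` (Lusin's property (N) from the `E_{M,k}` decomposition + Banach–Zarecki for monotone functions; Saks,
  *Theory of the Integral* VII §§6–10, IX).

The glue `logAC_of_stubs` (sorry-free, NOT a stub) turns `stub_acOfDini` + continuity of `ε`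
(`continuousAt_weilGroundEnergy`, PROVED) + antitonicity + `strictPos_of_stub` into `LogAC`
(`log` is Lipschitz on `[ε a, ∞)`), and `GronwallLeakage_of` closes the crux by the structure theorem.
`sorry` occurs only inside the `stub_*` (rev 3: only inside `stub_uniformWeilPositivity`).

Disproof.lean honoured: every stub lives on windows `a > 0` (`0 < b` load-bearing:
`gronwallLeakage_false_without_posB`); no constant / bounded rate is asserted (`not_gronwallLeakageConstRate`,
`not_gronwallLeakageBoundedRate`); the rate is `-deriv (log ∘ ε)` via the structure theorem, free to blow up at `0⁺`.
-/

-- `Summit.RiemannHypothesis.RiemannHypothesis.…` repeats a namespace component by design (D-0017 layout).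
set_option linter.dupNamespace false

noncomputable section

open MeasureTheory Set Filter
open scoped Topology NNReal

namespace Summit.RiemannHypothesis.RiemannHypothesis.Cruxes.GronwallLeakage.Sketch

open Literature.NumberTheory.LFunctions
open Summit.RiemannHypothesis.RiemannHypothesis.Theses.WeilWindowFlow (GronwallLeakage)
open Summit.RiemannHypothesis.Cruxes.GronwallLeakage.Negative

/-! ## Registered stubs -/

/-- **Stub 1 (`UniformWeilPositivity` = item stmt-RiemannHypothesis-0098 VERBATIM, RH-equivalent, held by the
lead).** Weil positivity on every truncated cone: for every window `a > 0` and every smooth `g` supported in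
`[-a, a]`, `Re W(g ⋆ g̃) ≥ 0`. Calibration (all landed, axioms standard): `↔ StrictPos`
(`strictPos_iff_uniformWeilPositivity`, p95911), `↔ RiemannHypothesis` (Yoshida's criterion
`riemannHypothesis_iff_forall_weilPositivityOn`), `↔ GronwallLeakage` (`gronwallLeakage_iff_uniformWeilPositivity`).
This is the signature of the open shared item 0098; no proof is claimed here. -/
theorem stub_uniformWeilPositivity :
    ∀ a : ℝ, 0 < a → Literature.NumberTheory.LFunctions.WeilPositivityOn a := by
  sorry

/-- **Old stub 1 (`StrictPos`) as sorry-free glue from the new one**: strict positivity of the window bottom at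
every window `a > 0` (`strictPos_iff_uniformWeilPositivity.2`, i.e. Yoshida + `strictUnderRH_proof`). -/
theorem strictPos_of_stub : ∀ a : ℝ, 0 < a → 0 < weilGroundEnergy a :=
  Summit.RiemannHypothesis.RiemannHypothesis.Theorems.WeilWindowFlowGronwallLeakage.strictPos_iff_uniformWeilPositivity.2
    stub_uniformWeilPositivity

/-- **Stub 2 (`FiniteDiniOffCountable`, unconditional, LANDED p90448).** Off a countable set of windows the lower-right
Dini derivate of `ε` is finite: for every `a > 0` outside `s` there is `M` with `ε (a + h) - ε a ≥ -M h` for all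
small `h > 0`. Implied by `WindowLipschitz` (crux 1039, `s = ∅`, `M = L(a, a+1)`) — now a tree theorem. -/
theorem stub_finiteDiniOffCountable :
    ∃ s : Set ℝ, s.Countable ∧ ∀ a : ℝ, 0 < a → a ∉ s →
      ∃ M : ℝ, ∀ᶠ h in 𝓝[>] (0 : ℝ), -(M * h) ≤ weilGroundEnergy (a + h) - weilGroundEnergy a :=
  -- LANDED (p90448): bridge from `WindowLipschitz_proof` (crux 1039, closed 2026-08-16T07:19Z)
  Summit.RiemannHypothesis.RiemannHypothesis.Theorems.WeilWindowFlowGronwallLeakage.stub_finiteDiniOffCountable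

/-- **Stub 3 (`acOfDini`, generic real analysis, LANDED p87117).** A continuous antitone function on `[b, a]` whose lower-right
Dini derivate is finite (`f (x + h) - f x ≥ -M h` for small `h > 0`) at every point of `[b, a)` outside a
countable set is absolutely continuous on `[b, a]`. (Monotone + continuous + Lusin (N) ⟹ AC, Banach–Zarecki;
(N) from the decomposition `E_{M,k} = {x : f (x+h) - f x ≥ -M h, 0 < h < 1/k}`: on a subinterval `I` of length
`< 1/k` the image `f (E_{M,k} ∩ I)` has outer measure `≤ M |I|`; a countable set has a null image.) -/
theorem stub_acOfDini :
    ∀ (f : ℝ → ℝ) (b a : ℝ), b ≤ a → ContinuousOn f (Icc b a) → AntitoneOn f (Icc b a) →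
      (∃ s : Set ℝ, s.Countable ∧ ∀ x ∈ Ico b a, x ∉ s →
        ∃ M : ℝ, ∀ᶠ h in 𝓝[>] (0 : ℝ), -(M * h) ≤ f (x + h) - f x) →
      AbsolutelyContinuousOnInterval f b a :=
  -- LANDED (p87117): Stieltjes measure of the clamped monotone function ≪ volume on the Dini sets, Radon–Nikodym
  Summit.RiemannHypothesis.RiemannHypothesis.Theorems.WeilWindowFlowGronwallLeakage.stub_acOfDini

/-! ## Sorry-free glue -/

/-- `log` is `η⁻¹`-Lipschitz on `[η, ∞)` for `η > 0` (as a `dist` inequality). [folklore] -/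
theorem dist_log_le_of_le {η x y : ℝ} (hη : 0 < η) (hx : η ≤ x) (hy : η ≤ y) :
    dist (Real.log x) (Real.log y) ≤ η⁻¹ * dist x y := by
  have hx0 : 0 < x := hη.trans_le hx
  have hy0 : 0 < y := hη.trans_le hy
  -- one-sided bound `log u - log v ≤ (u - v) / v ≤ |u - v| / η`
  have key : ∀ u v : ℝ, 0 < u → η ≤ v → Real.log u - Real.log v ≤ η⁻¹ * |u - v| := by
    intro u v hu hv
    have hv0 : 0 < v := hη.trans_le hv
    have h1 : Real.log u - Real.log v = Real.log (u / v) := (Real.log_div hu.ne' hv0.ne').symm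
    have h2 : Real.log (u / v) ≤ u / v - 1 := Real.log_le_sub_one_of_pos (div_pos hu hv0)
    have h3 : u / v - 1 = (u - v) / v := by field_simp
    have h4 : (u - v) / v ≤ |u - v| / η := by
      rw [div_le_div_iff₀ hv0 hη]
      calc (u - v) * η ≤ |u - v| * η := by gcongr; exact le_abs_self _
        _ ≤ |u - v| * v := by gcongr
    calc Real.log u - Real.log v = Real.log (u / v) := h1
      _ ≤ (u - v) / v := by rw [← h3]; exact h2
      _ ≤ |u - v| / η := h4
      _ = η⁻¹ * |u - v| := by rw [div_eq_inv_mul]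
  rw [Real.dist_eq, Real.dist_eq, abs_sub_le_iff]
  constructor
  · exact key x y hx0 hy
  · simpa [abs_sub_comm] using key y x hy0 hx

/-- **Glue (sorry-free): `LogAC` from the stub STATEMENTS.** From strict positivity, the nearly-everywhere finite
Dini derivate and the generic engine `stub_acOfDini`: `ε` is continuous on `[b, a] ⊂ (0, ∞)`
(`continuousAt_weilGroundEnergy`, Suzuki 2026 Thm 1.3, PROVED) and antitone (`weilGroundEnergy_antitone_of_pos'`),
hence absolutely continuous on `[b, a]`; `log` is Lipschitz on `[ε a, ∞) ∋ ε x`, so `log ∘ ε` is absolutely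
continuous on `[b, a]`. -/
theorem logAC_of_stubs
    (hpos : ∀ a : ℝ, 0 < a → 0 < weilGroundEnergy a)
    (hdini : ∃ s : Set ℝ, s.Countable ∧ ∀ a : ℝ, 0 < a → a ∉ s →
      ∃ M : ℝ, ∀ᶠ h in 𝓝[>] (0 : ℝ), -(M * h) ≤ weilGroundEnergy (a + h) - weilGroundEnergy a)
    (hac : ∀ (f : ℝ → ℝ) (b a : ℝ), b ≤ a → ContinuousOn f (Icc b a) → AntitoneOn f (Icc b a) →
      (∃ s : Set ℝ, s.Countable ∧ ∀ x ∈ Ico b a, x ∉ s →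
        ∃ M : ℝ, ∀ᶠ h in 𝓝[>] (0 : ℝ), -(M * h) ≤ f (x + h) - f x) →
      AbsolutelyContinuousOnInterval f b a) :
    ∀ b a : ℝ, 0 < b → b ≤ a →
      AbsolutelyContinuousOnInterval (fun x ↦ Real.log (weilGroundEnergy x)) b a := by
  intro b a hb hba
  -- continuity and antitonicity of `ε` on `[b, a]`
  have hcont : ContinuousOn weilGroundEnergy (Icc b a) := fun x hx ↦
    (continuousAt_weilGroundEnergy (hb.trans_le hx.1)).continuousWithinAt
  have hanti : AntitoneOn weilGroundEnergy (Icc b a) := fun x hx y _ hxy ↦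
    weilGroundEnergy_antitone_of_pos' (hb.trans_le hx.1) hxy
  -- the Dini hypothesis restricted to `[b, a)`
  have hdini' : ∃ s : Set ℝ, s.Countable ∧ ∀ x ∈ Ico b a, x ∉ s →
      ∃ M : ℝ, ∀ᶠ h in 𝓝[>] (0 : ℝ), -(M * h) ≤ weilGroundEnergy (x + h) - weilGroundEnergy x := by
    obtain ⟨s, hs, H⟩ := hdini
    exact ⟨s, hs, fun x hx hxs ↦ H x (hb.trans_le hx.1) hxs⟩
  have hAC : AbsolutelyContinuousOnInterval weilGroundEnergy b a := hac _ b a hba hcont hanti hdini'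
  -- `log` is Lipschitz on `[ε a, ∞)` and `ε` maps `[b, a]` into it
  have hεa : 0 < weilGroundEnergy a := hpos a (hb.trans_le hba)
  have hlip : LipschitzOnWith (Real.toNNReal (weilGroundEnergy a)⁻¹) Real.log (Ici (weilGroundEnergy a)) := by
    refine LipschitzOnWith.of_dist_le_mul fun x hx y hy ↦ ?_
    rw [Real.coe_toNNReal _ (inv_nonneg.2 hεa.le)]
    exact dist_log_le_of_le hεa hx hy
  have hmaps : MapsTo weilGroundEnergy (uIcc b a) (Ici (weilGroundEnergy a)) := by
    intro x hx
    rw [uIcc_of_le hba] at hx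
    exact weilGroundEnergy_antitone_of_pos' (hb.trans_le hx.1) hx.2
  exact hAC.comp_of_lipschitzOnWith hlip hmaps

/-! ## The crux from the stubs -/

/-- **`GronwallLeakage` from the registered stub** (the skeleton's crux proof term, line `Sketch` composition):
strict positivity (`strictPos_of_stub`, from `stub_uniformWeilPositivity`) and local absolute continuity of `log ε`
(`logAC_of_stubs` from the LANDED `stub_finiteDiniOffCountable` and `stub_acOfDini`) are exactly `X` by the landed
structure theorem `gronwallLeakage_iff_pos_and_logAC` (rate `C := -deriv (log ∘ ε)`, FTC for absolutely continuous
functions). No hypotheses; rev 3: `sorry` only inside `stub_uniformWeilPositivity` (= item 0098 ⟺ RH). -/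
theorem GronwallLeakage_of : GronwallLeakage :=
  gronwallLeakage_iff_pos_and_logAC.2
    ⟨strictPos_of_stub, logAC_of_stubs strictPos_of_stub stub_finiteDiniOffCountable stub_acOfDini⟩

/- The closing file, pre-written (kept as a comment: a crux-concluding theorem with a hypothesis is refused by
`ledger skeleton check` as `skeleton.extra-hypothesis`). When a term
`h : ∀ a : ℝ, 0 < a → Literature.NumberTheory.LFunctions.WeilPositivityOn a` closes item 0098,
`Theorems/WeilWindowFlowGronwallLeakage.lean` is the one-liner
  theorem GronwallLeakage_proof : GronwallLeakage :=
    Summit.RiemannHypothesis.RiemannHypothesis.Theorems.WeilWindowFlowGronwallLeakage.gronwallLeakage_iff_uniformWeilPositivity.2 h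
(p95911), or equivalently this skeleton with `stub_uniformWeilPositivity := h`. -/

end Summit.RiemannHypothesis.RiemannHypothesis.Cruxes.GronwallLeakage.Sketch

end
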